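import Summits.CriticalPhenomena.CardyFormulaZ2.Theses.CardySelfRefinement
import Summits.CriticalPhenomena.CardyFormulaZ2.Theorems.LagHandOff.Negative.ArcSwap
import Literature.Probability.RandomPlanarGeometry.NestedJordanFreeOrder
import Literature.Probability.RandomPlanarGeometry.ChordalReversibility
import Literature.Probability.RandomPlanarGeometry.PlanarDomainsTopology
import HarnessLib

/-!
# Arc correspondence for nested Dobrushin domains: helper for stub `stub_discreteLocality` (R3a) of
line `hitting-tournament` for crux `LagHandOff` (stmt-CriticalPhenomena-10268)

Pure plane topology.  Let `D' ⊆ D` be Dobrushin (two-marked Jordan) domains with the same marked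
points `a = pt 0`, `b = pt 1`, and `a ∉ closure (D ∖ D')`.  Then the orientation of `D'` can be
chosen (keeping `D'` or running its boundary loop backwards, `exists_orientationReversed`) so
that every COMMON boundary point `z ∈ ∂D ∩ ∂D'`, `z ≠ a, b`, lies on the arc `(ab)` of `D` iff it
lies on the arc `(ab)` of the re-oriented `D''`, and on `(ba)` of `D` iff on `(ba)` of `D''`
(`exists_arcCompatible`).  In particular a point of `D.arc 0` off `closure (D ∖ D') ∪ {a, b}` is
on `D''.arc 0` and not on `D''.arc 1`, and symmetrically (`exists_arcCompatible'`).

PROOF.  Both loops are re-based at `a` (`D.swap.swap`).  For two common points `z₁, z₂ ≠ a, b`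
the four "inconsistent" side patterns are excluded (`sides_consistent`) by the tree's
`JordanDomain.not_separated_of_nested` (Newman's cross-cut theorem in `D'` and in `D`) with a
cross-cut of `D'` from `a` to `z₁`, `z₂` or `b` (`MarkedDomain.exists_isCrosscut_pt_zero`; for `b`
applied to the auxiliary marking `(a, z₁)` of `D'`).
-/

noncomputable section

open Set Filter Topology Metric
open Literature.Probability.RandomPlanarGeometry Literature.Topology.PlaneTopology
open Summit.CriticalPhenomena.CardyFormulaZ2.Theorems.LagHandOff.Negative

namespace Summit.CriticalPhenomena.CardyFormulaZ2.Cruxes.LagHandOff.HittingTournament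

/-! ### Based Dobrushin domains: parameters of arc points -/

/-- For a Dobrushin domain based at parameter `0`, a boundary point with parameter `v ∈ (0, 1)`
lies on `arc 0 = ∂D[0, mark 1]` iff `v ≤ mark 1`. -/
theorem boundary_mem_arc_zero_iff {J : DobrushinDomain} (hJ : J.mark 0 = 0) {v : ℝ}
    (hv : v ∈ Ioo (0 : ℝ) 1) : J.boundary v ∈ J.arc 0 ↔ v ≤ J.mark 1 := by
  have hm1 : J.mark 1 < 1 := (J.mark_mem 1).2
  constructor
  · rintro ⟨w, hw, hwv⟩
    rw [MarkedDomain.nextMark_zero_two, hJ] at hw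
    have hweq : w = v :=
      J.injOn_boundary ⟨hw.1, hw.2.trans_lt hm1⟩ ⟨hv.1.le, hv.2⟩ hwv
    exact hweq ▸ hw.2
  · intro h
    refine ⟨v, ?_, rfl⟩
    rw [MarkedDomain.nextMark_zero_two, hJ]
    exact ⟨hv.1.le, h⟩

/-- For a Dobrushin domain based at parameter `0`, a boundary point with parameter `v ∈ (0, 1)`
lies on `arc 1 = ∂D[mark 1, 1]` iff `mark 1 ≤ v`. -/
theorem boundary_mem_arc_one_iff {J : DobrushinDomain} (hJ : J.mark 0 = 0) {v : ℝ}
    (hv : v ∈ Ioo (0 : ℝ) 1) : J.boundary v ∈ J.arc 1 ↔ J.mark 1 ≤ v := by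
  constructor
  · rintro ⟨w, hw, hwv⟩
    rw [MarkedDomain.nextMark_one_two, hJ, zero_add] at hw
    rcases hw.2.lt_or_eq with hw1 | hw1
    · have hweq : w = v :=
        J.injOn_boundary ⟨(J.mark_mem 1).1.trans hw.1, hw1⟩ ⟨hv.1.le, hv.2⟩ hwv
      exact hweq ▸ hw.1
    · exfalso
      rw [hw1, J.periodic_boundary.eq] at hwv
      have := J.injOn_boundary ⟨le_rfl, one_pos⟩ ⟨hv.1.le, hv.2⟩ hwv
      exact hv.1.ne this
  · intro h
    refine ⟨v, ?_, rfl⟩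
    rw [MarkedDomain.nextMark_one_two, hJ, zero_add]
    exact ⟨h, hv.2.le⟩

/-- Every boundary point other than `a = boundary 0` of a based Dobrushin domain has a parameter
in `(0, 1)`. -/
theorem exists_param_of_mem_frontier {J : DobrushinDomain} (hJ : J.mark 0 = 0) {z : ℂ}
    (hz : z ∈ frontier J.carrier) (hza : z ≠ J.pt 0) : ∃ v ∈ Ioo (0 : ℝ) 1, J.boundary v = z := by
  rw [J.frontier_eq_image_Ico] at hz
  obtain ⟨v, hv, rfl⟩ := hz
  have hv0 : v ≠ 0 := by
    rintro rfl
    exact hza (by rw [MarkedDomain.pt, hJ])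
  exact ⟨v, ⟨lt_of_le_of_ne hv.1 (Ne.symm hv0), hv.2⟩, rfl⟩

/-- A parameter in `(0, 1)` is not the parameter of `a`. -/
theorem boundary_ne_pt_zero {J : DobrushinDomain} (hJ : J.mark 0 = 0) {v : ℝ} (hv : v ∈ Ioo (0 : ℝ) 1) :
    J.boundary v ≠ J.pt 0 := by
  rw [MarkedDomain.pt_zero_eq_boundary_zero hJ]
  intro h
  exact hv.1.ne' (J.injOn_boundary ⟨hv.1.le, hv.2⟩ ⟨le_rfl, one_pos⟩ h)

/-- A parameter in `(0, 1)` other than `mark 1` is not the parameter of `b`. -/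
theorem boundary_ne_pt_one {J : DobrushinDomain} {v : ℝ} (hv : v ∈ Ioo (0 : ℝ) 1)
    (hvb : v ≠ J.mark 1) : J.boundary v ≠ J.pt 1 := by
  intro h
  exact hvb (J.injOn_boundary ⟨hv.1.le, hv.2⟩ (J.mark_mem 1) h)

/-- **Off the marked points, the two arcs are complementary in the boundary.** -/
theorem mem_arc_one_iff_not_mem_arc_zero (D : DobrushinDomain) {z : ℂ} (hz : z ∈ frontier D.carrier)
    (hza : z ≠ D.pt 0) (hzb : z ≠ D.pt 1) : z ∈ D.arc 1 ↔ z ∉ D.arc 0 := by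
  -- re-base the loop at `a`
  set J : DobrushinDomain := D.swap.swap with hJd
  have hJ : J.mark 0 = 0 := rfl
  have hJ0 : J.arc 0 = D.arc 0 := by rw [hJd, MarkedDomain.arc_swap_zero, MarkedDomain.arc_swap_one]
  have hJ1 : J.arc 1 = D.arc 1 := by rw [hJd, MarkedDomain.arc_swap_one, MarkedDomain.arc_swap_zero]
  have hJa : J.pt 0 = D.pt 0 := by rw [hJd, MarkedDomain.pt_swap_zero, MarkedDomain.pt_swap_one]
  have hJb : J.pt 1 = D.pt 1 := by rw [hJd, MarkedDomain.pt_swap_one, MarkedDomain.pt_swap_zero]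
  have hzJ : z ∈ frontier J.carrier := hz
  obtain ⟨v, hv, rfl⟩ := exists_param_of_mem_frontier hJ hzJ (hJa ▸ hza)
  have hvb : v ≠ J.mark 1 := by
    rintro rfl
    exact hzb (hJb ▸ rfl)
  rw [← hJ0, ← hJ1, boundary_mem_arc_zero_iff hJ hv, boundary_mem_arc_one_iff hJ hv, not_le]
  exact ⟨fun h => lt_of_le_of_ne h (Ne.symm hvb), le_of_lt⟩

/-! ### The core separation lemma -/

/-- **Consistency of sides for two common boundary points.** Let `J' ⊆ J` be Dobrushin domains
based at the common point `a = pt 0` (`mark 0 = 0`), with the same `b = pt 1`, `a` off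
`closure (J ∖ J')`, and let `z₁ = J'.boundary u₁ = J.boundary v₁`, `z₂ = J'.boundary u₂ = J.boundary v₂`
be two common boundary points other than `a, b` (parameters in `(0, 1)`, not `mark 1`).  It is
impossible that `z₁` lies on corresponding arcs of `J` and `J'` while `z₂` does not. -/
theorem sides_consistent {J J' : DobrushinDomain} (hJ : J.mark 0 = 0) (hJ' : J'.mark 0 = 0)
    (hsub : J'.carrier ⊆ J.carrier) (h0 : J'.pt 0 = J.pt 0) (h1 : J'.pt 1 = J.pt 1)
    (ha : J.pt 0 ∉ closure (J.carrier \ J'.carrier))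
    {v₁ v₂ u₁ u₂ : ℝ} (hv₁ : v₁ ∈ Ioo (0 : ℝ) 1) (hv₂ : v₂ ∈ Ioo (0 : ℝ) 1)
    (hu₁ : u₁ ∈ Ioo (0 : ℝ) 1) (hu₂ : u₂ ∈ Ioo (0 : ℝ) 1)
    (hz₁ : J'.boundary u₁ = J.boundary v₁) (hz₂ : J'.boundary u₂ = J.boundary v₂)
    (hv₁b : v₁ ≠ J.mark 1) (hv₂b : v₂ ≠ J.mark 1) (hu₁b : u₁ ≠ J'.mark 1) (hu₂b : u₂ ≠ J'.mark 1) :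
    ¬ ((v₁ < J.mark 1 ↔ u₁ < J'.mark 1) ∧ ¬ (v₂ < J.mark 1 ↔ u₂ < J'.mark 1)) := by
  set β := J.mark 1 with hβ
  set β' := J'.mark 1 with hβ'
  have hβI : β ∈ Ioo (0 : ℝ) 1 := ⟨hJ ▸ J.mark_zero_lt_mark_one, (J.mark_mem 1).2⟩
  have hβ'I : β' ∈ Ioo (0 : ℝ) 1 := ⟨hJ' ▸ J'.mark_zero_lt_mark_one, (J'.mark_mem 1).2⟩
  have h00 : J'.boundary 0 = J.boundary 0 := by
    rw [← MarkedDomain.pt_zero_eq_boundary_zero hJ, ← MarkedDomain.pt_zero_eq_boundary_zero hJ']; exact h0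
  have hfree : J.boundary 0 ∉ closure (J.carrier \ J'.carrier) := MarkedDomain.pt_zero_eq_boundary_zero hJ ▸ ha
  have hbb : J'.boundary β' = J.boundary β := h1
  -- cross-cuts of `J'` from `a` to a boundary point `J'.boundary u`, `u ∈ (0, 1)`, `u ≠ β'`
  have hcut : ∀ {u : ℝ}, u ∈ Ioo (0 : ℝ) 1 → u ≠ β' →
      ∃ L : Set ℂ, J'.IsCrosscut L (J'.boundary 0) (J'.boundary u) := by
    intro u hu hub
    have h := MarkedDomain.exists_isCrosscut_pt_zero J' (J'.boundary_mem_frontier u)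
      (boundary_ne_pt_zero hJ' hu) (boundary_ne_pt_one hu hub)
    rwa [MarkedDomain.pt_zero_eq_boundary_zero hJ'] at h
  -- a cross-cut of `J'` from `a` to `b`, from the auxiliary marking `(a, z₁)`
  have hcutb : ∃ L : Set ℂ, J'.IsCrosscut L (J'.boundary 0) (J'.boundary β') := by
    let J₁ : DobrushinDomain :=
      { toJordanDomain := J'.toJordanDomain
        mark := ![0, u₁]
        strictMono_mark := by
          refine Fin.strictMono_iff_lt_succ.2 fun k => ?_
          fin_cases k
          exact hu₁.1
        mark_mem := by
          intro k
          fin_cases k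
          · exact ⟨le_rfl, one_pos⟩
          · exact ⟨hu₁.1.le, hu₁.2⟩ }
    have hp0 : J₁.pt 0 = J'.boundary 0 := rfl
    have hp1 : J₁.pt 1 = J'.boundary u₁ := rfl
    have hq0 : J'.boundary β' ≠ J₁.pt 0 := by
      rw [hp0, ← MarkedDomain.pt_zero_eq_boundary_zero hJ']
      exact boundary_ne_pt_zero hJ' hβ'I
    have hq1 : J'.boundary β' ≠ J₁.pt 1 := by
      rw [hp1]
      intro h
      exact hu₁b (J'.injOn_boundary ⟨hu₁.1.le, hu₁.2⟩ (J'.mark_mem 1) h.symm)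
    obtain ⟨L, hL⟩ := MarkedDomain.exists_isCrosscut_pt_zero J₁ (J'.boundary_mem_frontier β') hq0 hq1
    exact ⟨L, hL⟩
  -- the tree's separation theorem, specialised
  have key : ∀ {s s' : ℝ}, s ∈ Ioo (0 : ℝ) 1 → s' ∈ Ioo (0 : ℝ) 1 → J'.boundary s' = J.boundary s →
      (∃ L : Set ℂ, J'.IsCrosscut L (J'.boundary 0) (J'.boundary s')) →
      ∀ {p₁ p₂ q₁ q₂ : ℝ}, p₁ ∈ Ioo 0 s' → p₂ ∈ Ioo s' 1 →
      J'.boundary p₁ = J.boundary q₁ → J'.boundary p₂ = J.boundary q₂ →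
      ((q₁ ∈ Ioo s 1 ∧ q₂ ∈ Ioo s 1) ∨ (q₁ ∈ Ioo 0 s ∧ q₂ ∈ Ioo 0 s)) → False := by
    intro s s' hs hs' hq hL p₁ p₂ q₁ q₂ hp₁ hp₂ hw₁ hw₂ hv
    obtain ⟨L, hL⟩ := hL
    exact JordanDomain.not_separated_of_nested hsub hs hs' h00 hq hL hfree hp₁ hp₂ hw₁ hw₂ hv
  rintro ⟨h₁, h₂⟩
  -- distinct parameters on `∂J` give distinct parameters on `∂J'`
  have hne : ∀ {u u' v v' : ℝ}, J'.boundary u = J.boundary v → J'.boundary u' = J.boundary v' →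
      v ∈ Ioo (0 : ℝ) 1 → v' ∈ Ioo (0 : ℝ) 1 → v < v' → u ≠ u' := by
    intro u u' v v' h h' hvI hv'I hlt huu
    rw [huu] at h
    have := J.injOn_boundary ⟨hvI.1.le, hvI.2⟩ ⟨hv'I.1.le, hv'I.2⟩ (h.symm.trans h')
    exact hlt.ne this
  by_cases hc₁ : v₁ < β
  · have hc₁' : u₁ < β' := h₁.1 hc₁
    by_cases hc₂ : v₂ < β
    · -- `z₂` on `(ab)` of `J` but on `(ba)` of `J'`: separate `{z₁, z₂}` by `{a, b}`
      have hc₂' : β' < u₂ := lt_of_le_of_ne (not_lt.1 fun h => h₂ ⟨fun _ => h, fun _ => hc₂⟩) (Ne.symm hu₂b)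
      exact key hβI hβ'I hbb hcutb ⟨hu₁.1, hc₁'⟩ ⟨hc₂', hu₂.2⟩ hz₁ hz₂
        (Or.inr ⟨⟨hv₁.1, hc₁⟩, ⟨hv₂.1, hc₂⟩⟩)
    · -- `z₂` on `(ba)` of `J` but on `(ab)` of `J'`
      have hc₂v : β < v₂ := lt_of_le_of_ne (not_lt.1 hc₂) (Ne.symm hv₂b)
      have hc₂' : u₂ < β' := by
        by_contra h
        exact h₂ ⟨fun h' => absurd h' hc₂, fun h' => absurd h' h⟩
      rcases lt_trichotomy u₁ u₂ with h12 | h12 | h12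
      · -- cut at `z₂`: `z₁` and `b` are separated on `∂J'`, not on `∂J`
        exact key hv₂ hu₂ hz₂ (hcut hu₂ hu₂b) ⟨hu₁.1, h12⟩ ⟨hc₂', hβ'I.2⟩ hz₁ hbb
          (Or.inr ⟨⟨hv₁.1, hc₁.trans hc₂v⟩, ⟨hβI.1, hc₂v⟩⟩)
      · exact absurd h12 (hne hz₁ hz₂ hv₁ hv₂ (hc₁.trans hc₂v))
      · -- cut at `z₁`: `z₂` and `b` are separated on `∂J'`, not on `∂J`
        exact key hv₁ hu₁ hz₁ (hcut hu₁ hu₁b) ⟨hu₂.1, h12⟩ ⟨hc₁', hβ'I.2⟩ hz₂ hbb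
          (Or.inl ⟨⟨hc₁.trans hc₂v, hv₂.2⟩, ⟨hc₁, hβI.2⟩⟩)
  · have hc₁v : β < v₁ := lt_of_le_of_ne (not_lt.1 hc₁) (Ne.symm hv₁b)
    have hc₁' : β' < u₁ := lt_of_le_of_ne (not_lt.1 fun h => hc₁ (h₁.2 h)) (Ne.symm hu₁b)
    by_cases hc₂ : v₂ < β
    · -- `z₂` on `(ab)` of `J` but on `(ba)` of `J'`
      have hc₂' : β' < u₂ := lt_of_le_of_ne (not_lt.1 fun h => h₂ ⟨fun _ => h, fun _ => hc₂⟩) (Ne.symm hu₂b)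
      rcases lt_trichotomy u₁ u₂ with h12 | h12 | h12
      · -- cut at `z₁`: `b` and `z₂` are separated on `∂J'`, not on `∂J`
        exact key hv₁ hu₁ hz₁ (hcut hu₁ hu₁b) ⟨hβ'I.1, hc₁'⟩ ⟨h12, hu₂.2⟩ hbb hz₂
          (Or.inr ⟨⟨hβI.1, hc₁v⟩, ⟨hv₂.1, hc₂.trans hc₁v⟩⟩)
      · exact absurd h12.symm (hne hz₂ hz₁ hv₂ hv₁ (hc₂.trans hc₁v))
      · -- cut at `z₂`: `b` and `z₁` are separated on `∂J'`, not on `∂J`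
        exact key hv₂ hu₂ hz₂ (hcut hu₂ hu₂b) ⟨hβ'I.1, hc₂'⟩ ⟨h12, hu₁.2⟩ hbb hz₁
          (Or.inl ⟨⟨hc₂, hβI.2⟩, ⟨hc₂.trans hc₁v, hv₁.2⟩⟩)
    · -- `z₂` on `(ba)` of `J` but on `(ab)` of `J'`: separate `{z₂, z₁}` by `{a, b}`
      have hc₂v : β < v₂ := lt_of_le_of_ne (not_lt.1 hc₂) (Ne.symm hv₂b)
      have hc₂' : u₂ < β' := by
        by_contra h
        exact h₂ ⟨fun h' => absurd h' hc₂, fun h' => absurd h' h⟩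
      exact key hβI hβ'I hbb hcutb ⟨hu₂.1, hc₂'⟩ ⟨hc₁', hu₁.2⟩ hz₂ hz₁
        (Or.inl ⟨⟨hc₂v, hv₂.2⟩, ⟨hc₁v, hv₁.2⟩⟩)

/-! ### Choosing the orientation of the inner domain -/

/-- **Arc correspondence for nested Dobrushin domains.** For Dobrushin domains `D' ⊆ D` with the
same marked points and `a = pt 0 ∉ closure (D ∖ D')` there is a Dobrushin structure `D''` on
`(D'.carrier; a, b)` (namely `D'` or its orientation reversal) such that every common boundary
point other than `a, b` lies on `D.arc i` iff it lies on `D''.arc i` (`i = 0, 1`). -/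
theorem exists_arcCompatible (D D' : DobrushinDomain) (hsub : D'.carrier ⊆ D.carrier)
    (h0 : D'.pt 0 = D.pt 0) (h1 : D'.pt 1 = D.pt 1) (ha : D.pt 0 ∉ closure (D.carrier \ D'.carrier)) :
    ∃ D'' : DobrushinDomain, D''.carrier = D'.carrier ∧ D''.pt 0 = D'.pt 0 ∧ D''.pt 1 = D'.pt 1 ∧
      ∀ z ∈ frontier D.carrier, z ∈ frontier D'.carrier → z ≠ D.pt 0 → z ≠ D.pt 1 →
        (z ∈ D.arc 0 ↔ z ∈ D''.arc 0) ∧ (z ∈ D.arc 1 ↔ z ∈ D''.arc 1) := by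
  -- re-base both loops at `a`
  set J : DobrushinDomain := D.swap.swap with hJd
  have hJ : J.mark 0 = 0 := rfl
  have hJc : J.carrier = D.carrier := rfl
  have hJ0 : J.arc 0 = D.arc 0 := by rw [hJd, MarkedDomain.arc_swap_zero, MarkedDomain.arc_swap_one]
  have hJa : J.pt 0 = D.pt 0 := by rw [hJd, MarkedDomain.pt_swap_zero, MarkedDomain.pt_swap_one]
  have hJb : J.pt 1 = D.pt 1 := by rw [hJd, MarkedDomain.pt_swap_one, MarkedDomain.pt_swap_zero]
  set J' : DobrushinDomain := D'.swap.swap with hJ'd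
  have hJ' : J'.mark 0 = 0 := rfl
  have hJ'c : J'.carrier = D'.carrier := rfl
  have hJ'0 : J'.arc 0 = D'.arc 0 := by rw [hJ'd, MarkedDomain.arc_swap_zero, MarkedDomain.arc_swap_one]
  have hJ'a : J'.pt 0 = D'.pt 0 := by rw [hJ'd, MarkedDomain.pt_swap_zero, MarkedDomain.pt_swap_one]
  have hJ'b : J'.pt 1 = D'.pt 1 := by rw [hJ'd, MarkedDomain.pt_swap_one, MarkedDomain.pt_swap_zero]
  -- the side of a common point in terms of parameters
  have hside : ∀ {z : ℂ}, z ∈ frontier D.carrier → z ∈ frontier D'.carrier → z ≠ D.pt 0 → z ≠ D.pt 1 →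
      ∃ v ∈ Ioo (0 : ℝ) 1, ∃ u ∈ Ioo (0 : ℝ) 1, J.boundary v = z ∧ J'.boundary u = z ∧
        v ≠ J.mark 1 ∧ u ≠ J'.mark 1 ∧ (z ∈ D.arc 0 ↔ v < J.mark 1) ∧ (z ∈ D'.arc 0 ↔ u < J'.mark 1) := by
    intro z hz hz' hza hzb
    obtain ⟨v, hv, rfl⟩ := exists_param_of_mem_frontier hJ (show z ∈ frontier J.carrier from hz) (hJa ▸ hza)
    obtain ⟨u, hu, hzu⟩ := exists_param_of_mem_frontier hJ' (show J.boundary v ∈ frontier J'.carrier from hz')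
      (by rw [hJ'a, h0]; exact hza)
    have hvb : v ≠ J.mark 1 := by
      rintro rfl; exact hzb (hJb ▸ rfl)
    have hub : u ≠ J'.mark 1 := by
      rintro rfl
      exact hzb (by rw [← hzu, ← h1, ← hJ'b]; rfl)
    refine ⟨v, hv, u, hu, rfl, hzu, hvb, hub, ?_, ?_⟩
    · rw [← hJ0, boundary_mem_arc_zero_iff hJ hv]
      exact ⟨fun h => lt_of_le_of_ne h hvb, le_of_lt⟩
    · rw [← hJ'0, ← hzu, boundary_mem_arc_zero_iff hJ' hu]
      exact ⟨fun h => lt_of_le_of_ne h hub, le_of_lt⟩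
  have hcompl : ∀ {z : ℂ}, z ∈ frontier D.carrier → z ≠ D.pt 0 → z ≠ D.pt 1 → (z ∈ D.arc 1 ↔ z ∉ D.arc 0) :=
    fun hz hza hzb => mem_arc_one_iff_not_mem_arc_zero D hz hza hzb
  have hcompl' : ∀ {z : ℂ}, z ∈ frontier D'.carrier → z ≠ D.pt 0 → z ≠ D.pt 1 → (z ∈ D'.arc 1 ↔ z ∉ D'.arc 0) :=
    fun hz hza hzb => mem_arc_one_iff_not_mem_arc_zero D' hz (h0.symm ▸ hza) (h1.symm ▸ hzb)
  by_cases hex : ∃ z ∈ frontier D.carrier, z ∈ frontier D'.carrier ∧ z ≠ D.pt 0 ∧ z ≠ D.pt 1 ∧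
      ¬ (z ∈ D.arc 0 ↔ z ∈ D'.arc 0)
  · -- an inconsistent common point: reverse the orientation of `D'`
    obtain ⟨z₀, hz₀, hz₀', hz₀a, hz₀b, hz₀s⟩ := hex
    obtain ⟨R, hRc, hR0, hR1, hRA, hRB⟩ := exists_orientationReversed D'
    refine ⟨R, hRc, hR0, hR1, fun z hz hz' hza hzb => ?_⟩
    obtain ⟨v, hv, u, hu, hzv, hzu, hvb, hub, hsv, hsu⟩ := hside hz hz' hza hzb
    obtain ⟨v₀, hv₀, u₀, hu₀, hzv₀, hzu₀, hv₀b, hu₀b, hsv₀, hsu₀⟩ := hside hz₀ hz₀' hz₀a hz₀b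
    have hnot : ¬ (z ∈ D.arc 0 ↔ z ∈ D'.arc 0) := by
      intro hzs
      refine sides_consistent hJ hJ' hsub (hJ'a.trans (h0.trans hJa.symm)) (hJ'b.trans (h1.trans hJb.symm))
        (hJa.symm ▸ ha) hv hv₀ hu hu₀ (hzu.trans hzv.symm) (hzu₀.trans hzv₀.symm) hvb hv₀b hub hu₀b ⟨?_, ?_⟩
      · rwa [← hsv, ← hsu]
      · rwa [← hsv₀, ← hsu₀]
    rw [hRA, hRB, hcompl hz hza hzb, hcompl' hz' hza hzb]
    tauto
  · -- all common points are consistent: keep `D'`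
    push Not at hex
    refine ⟨D', rfl, rfl, rfl, fun z hz hz' hza hzb => ?_⟩
    have h := hex z hz hz' hza hzb
    rw [hcompl hz hza hzb, hcompl' hz' hza hzb]
    tauto

/-! ### The form consumed by the lattice argument -/

/-- Common free boundary points: a boundary point of `D` off `closure (D ∖ D')` is a boundary point
of `D' ⊆ D`. -/
theorem mem_frontier_inner_of_not_mem_closure_diff {D D' : Set ℂ} (hsub : D' ⊆ D)
    {z : ℂ} (hz : z ∈ frontier D) (hzF : z ∉ closure (D \ D')) : z ∈ frontier D' := by
  rw [frontier_eq_closure_inter_closure] at hz ⊢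
  refine ⟨?_, closure_mono (compl_subset_compl.2 hsub) hz.2⟩
  -- near `z` the two sets agree
  obtain ⟨r, hr, hball⟩ : ∃ r > 0, ball z r ⊆ (closure (D \ D'))ᶜ :=
    Metric.isOpen_iff.1 isClosed_closure.isOpen_compl z hzF
  have hz1 := hz.1
  rw [Metric.mem_closure_iff] at hz1 ⊢
  intro ε hε
  obtain ⟨w, hw, hwd⟩ := hz1 (min ε r) (lt_min hε hr)
  refine ⟨w, ?_, hwd.trans_le (min_le_left _ _)⟩
  by_contra hwD'
  have hwB : w ∈ ball z r := by rw [mem_ball, dist_comm]; exact hwd.trans_le (min_le_right _ _)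
  exact hball hwB (subset_closure ⟨hw, hwD'⟩)

/-- **Arc correspondence, disjointness form.** For Dobrushin domains `D' ⊆ D` with the same marked
points and `a ∉ closure (D ∖ D')` there is a Dobrushin structure `D''` on `(D'.carrier; a, b)` such
that, off `closure (D ∖ D') ∪ {a, b}`, the arc `(ab)` of `D` lies on the arc `(ab)` of `D''` and
misses its arc `(ba)`, and symmetrically. -/
theorem exists_arcCompatible' (D D' : DobrushinDomain) (hsub : D'.carrier ⊆ D.carrier)
    (h0 : D'.pt 0 = D.pt 0) (h1 : D'.pt 1 = D.pt 1) (ha : D.pt 0 ∉ closure (D.carrier \ D'.carrier)) :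
    ∃ D'' : DobrushinDomain, D''.carrier = D'.carrier ∧ D''.pt 0 = D.pt 0 ∧ D''.pt 1 = D.pt 1 ∧
      (∀ z ∈ D.arc 0, z ∉ closure (D.carrier \ D'.carrier) → z ∈ D''.arc 0) ∧
      (∀ z ∈ D.arc 1, z ∉ closure (D.carrier \ D'.carrier) → z ∈ D''.arc 1) ∧
      (∀ z ∈ D.arc 0, z ∉ closure (D.carrier \ D'.carrier) → z ≠ D.pt 0 → z ≠ D.pt 1 → z ∉ D''.arc 1) ∧
      (∀ z ∈ D.arc 1, z ∉ closure (D.carrier \ D'.carrier) → z ≠ D.pt 0 → z ≠ D.pt 1 → z ∉ D''.arc 0) := by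
  obtain ⟨D'', hc, hp0, hp1, h⟩ := exists_arcCompatible D D' hsub h0 h1 ha
  have hp0' : D''.pt 0 = D.pt 0 := hp0.trans h0
  have hp1' : D''.pt 1 = D.pt 1 := hp1.trans h1
  have hfr : ∀ {z : ℂ}, z ∈ frontier D.carrier → z ∉ closure (D.carrier \ D'.carrier) →
      z ∈ frontier D'.carrier := fun hz hzF =>
    mem_frontier_inner_of_not_mem_closure_diff hsub hz hzF
  have hcompl'' : ∀ {z : ℂ}, z ∈ frontier D'.carrier → z ≠ D.pt 0 → z ≠ D.pt 1 →
      (z ∈ D''.arc 1 ↔ z ∉ D''.arc 0) := fun {z} hz hza hzb =>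
    mem_arc_one_iff_not_mem_arc_zero D'' (show z ∈ frontier D''.carrier by rw [hc]; exact hz)
      (hp0'.symm ▸ hza) (hp1'.symm ▸ hzb)
  refine ⟨D'', hc, hp0', hp1', fun z hz hzF => ?_, fun z hz hzF => ?_, fun z hz hzF hza hzb => ?_,
    fun z hz hzF hza hzb => ?_⟩
  · by_cases hza : z = D.pt 0
    · rw [hza, ← hp0']; exact D''.pt_mem_arc_self 0
    by_cases hzb : z = D.pt 1
    · rw [hzb, ← hp1']; simpa using D''.pt_succ_mem_arc 0
    have hzf := D.arc_subset_frontier 0 hz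
    exact ((h z hzf (hfr hzf hzF) hza hzb).1).1 hz
  · by_cases hza : z = D.pt 0
    · rw [hza, ← hp0']; simpa using D''.pt_succ_mem_arc 1
    by_cases hzb : z = D.pt 1
    · rw [hzb, ← hp1']; exact D''.pt_mem_arc_self 1
    have hzf := D.arc_subset_frontier 1 hz
    exact ((h z hzf (hfr hzf hzF) hza hzb).2).1 hz
  · have hzf := D.arc_subset_frontier 0 hz
    have hzf' := hfr hzf hzF
    rw [hcompl'' hzf' hza hzb, not_not]
    exact ((h z hzf hzf' hza hzb).1).1 hz
  · have hzf := D.arc_subset_frontier 1 hz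
    have hzf' := hfr hzf hzF
    intro h0'
    have h1' : z ∈ D''.arc 1 := ((h z hzf hzf' hza hzb).2).1 hz
    exact (hcompl'' hzf' hza hzb).1 h1' h0'

/-! ### Registered sub-goal (one-line signature, verbatim) -/

/-- **Registered sub-goal `stub_discreteLocality_arcs` of `stub_discreteLocality`**: the arc
correspondence `exists_arcCompatible'`, fully quantified. -/
theorem stub_discreteLocality_arcs : ∀ D D' : DobrushinDomain, D'.carrier ⊆ D.carrier → D'.pt 0 = D.pt 0 → D'.pt 1 = D.pt 1 → D.pt 0 ∉ closure (D.carrier \ D'.carrier) → ∃ D'' : DobrushinDomain, D''.carrier = D'.carrier ∧ D''.pt 0 = D.pt 0 ∧ D''.pt 1 = D.pt 1 ∧ (∀ z ∈ D.arc 0, z ∉ closure (D.carrier \ D'.carrier) → z ∈ D''.arc 0) ∧ (∀ z ∈ D.arc 1, z ∉ closure (D.carrier \ D'.carrier) → z ∈ D''.arc 1) ∧ (∀ z ∈ D.arc 0, z ∉ closure (D.carrier \ D'.carrier) → z ≠ D.pt 0 → z ≠ D.pt 1 → z ∉ D''.arc 1) ∧ (∀ z ∈ D.arc 1, z ∉ closure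 (D.carrier \ D'.carrier) → z ≠ D.pt 0 → z ≠ D.pt 1 → z ∉ D''.arc 0) :=
  fun D D' hsub h0 h1 ha => exists_arcCompatible' D D' hsub h0 h1 ha

end Summit.CriticalPhenomena.CardyFormulaZ2.Cruxes.LagHandOff.HittingTournament

end
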